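import Summits.Ventures.CertifiedManyBodySolver.Rows.CorrWindowCertKernelEomAuto
import HarnessLib

/-!
# Two-level Gram by ROWS (one slice per block row — no per-pair spine) and by HALF ROWS (partners `b ≥ a` only, off-diagonal doubled:
# products ÷2), the anti-Hermitian remainder absorbed into the closer's adjoint family; closers `…GXNear` / `…GXAuto` / `…TBRowsHalfAuto`

HONEST FRAMING: Lean plumbing towards «tier P» (cell hubbard-obs). Two measured facts drive this file: (S1, HOME/STATUS 2026-08-29T00:50:31Z)
before every chain step the kernel evaluates `slices.getD i []`, which on the per-PAIR Gram slice list (`gramTBslices`, ≈ 8·10⁵ cells at Rm2)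
walks the whole earlier spine and FAILS for late steps; (L1, algo-p2 g29 00:50:34Z) a per-declaration kernel resource cap of ≈ 100–150 s of
reduction makes CAR products the budget (≈ 1 600–3 200 per step). Here:
(§1) `gramTB1Rows`/`gramTBRows K blocks` — ONE slice per (block, row `a`) = the products of `a` with every `b` of its block (≈ Σ n_k ≈ 2·10⁴
cells at Rm2, trivially indexed; steps regroup rows with `groupSlices … ns`), `flatten_gramTBRows`, `termOp_flatten_gramTBRows` (= the
`hTG` of the abstract-Gram closers with `TGs := gramTBRows K blocks`);
(§2) `gramTB1RowsHalf`/`gramTBRowsHalf K blocks` — row `a` against `b = a` once and the LATER rows doubled (the exporter's «adjoint-pair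
halving»), the strict lower part `lowerTB` (named in proofs, never evaluated), and the identity
`termOp (gramTBRowsHalf K blocks).flatten = termOp (gramTB K blocks) − termOp (lowerTB K blocks) + (termOp (lowerTB K blocks))ᴴ`
(the integer Gram is symmetric: `idot_comm`; a pair and its swap are adjoint: `termOp_pairT_swap`);
(§3) `termOp_residTG_gramX` — a Gram slice list that denotes `G − V + Vᴴ` gives the SAME residual as the full Gram with `V` appended to the
anti-Hermitian family `AV` (whose real expectations vanish in the Literature theorem) — `V` is a proof object, never a kernel slice;
(§4) closers `affineOrbitLowerRowN_of_quotAdjChainKernelCertGXNear` (explicit masks) / `…GXAuto` (kernel masks): the closer of record with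
`hTG` replaced by `hTGf : termOp d TGf = gramForm Λm O` for a NAMED full list + `hX : termOp d TGs.flatten = termOp d TGf − termOp d V +
(termOp d V)ᴴ`; and the two-level instance `…TBRowsHalfAuto` (`TGs := gramTBRowsHalf K blocks`, everything else discharged here). The kernel
accumulator is unchanged by halving because `stepEQA`'s adjoint pass identifies `m` with `NF(m†)` (exporter-side EQUAL run). Nothing of
record; no certificate evaluated; CONTROL/CALIBRATION context (wording (xx1)); silent on the presence of superconductivity; not a `T_c` or
phase sentence; nothing about any material; no summit statement is proved by this file. Seat hubbard-obs-p2 (STIFFNESS),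
`prover-hubbard-obs-p2-g24-0`, zero compute.

References: X. Han, arXiv:2006.06002 §2 eq. (2), §3 [Han2020Bootstrap]; J. Wang et al., PRX 14 (2024) 031006 §III [WangEtAl2024];
C. Jansson, D. Chaykin, C. Keil, SIAM J. Numer. Anal. 46 (2008) 180 [JanssonChaykinKeil2008]; O. Bratteli, D. W. Robinson, *Operator
Algebras and Quantum Statistical Mechanics 2* §5.2.2 [BratteliRobinsonII1997].
-/

namespace Summit.Ventures.CertifiedManyBodySolver

namespace CARPolyWindow

open Summit.Ventures.CertifiedQuantumChemistry Summit.Ventures.CertifiedQuantumChemistry.CARPoly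
open Literature.MathematicalPhysics.QuantumLattice Literature.MathematicalPhysics.QuantumLattice.HubbardWave0
open Literature.MathematicalPhysics.QuantumManyBody.StateRelaxation
open Literature.Probability.LatticeModels ThermodynamicLimit Filter Topology
open Matrix
open scoped ComplexOrder BigOperators

/-! ## §1 Two-level Gram by rows -/

section Rows

variable {α : Type*}

/-- The product term list of an ordered pair of block rows: `(r_a·r_b / 4^K) · v_a† v_b`. [cite: Han2020Bootstrap, §2 eq. (2)] -/
def pairT (K : ℕ) (a b : List ℤ × Terms α) : Terms α := scaleT ((idot a.1 b.1 : ℚ) / 4 ^ K) (mulT (daggerT a.2) b.2)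

/-- The DOUBLED product term list of a pair (off-diagonal entries of the half emission). [folklore] -/
def pair2T (K : ℕ) (a b : List ℤ × Terms α) : Terms α := scaleT ((2 * idot a.1 b.1 : ℚ) / 4 ^ K) (mulT (daggerT a.2) b.2)

/-- **Row-sliced block**: one slice per row `a` = the products of `a` with every row of the block. [cite: WangEtAl2024, §III] -/
def gramTB1Rows (K : ℕ) (RV : List (List ℤ × Terms α)) : List (Terms α) := RV.map fun a => RV.flatMap fun b => pairT K a b

/-- **Row-sliced two-level Gram**: the row slices of all blocks. [cite: WangEtAl2024, §III] -/
def gramTBRows (K : ℕ) (blocks : List (List (List ℤ × Terms α))) : List (Terms α) := blocks.flatMap (gramTB1Rows K)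

/-- `gramTB1` is the pair double `flatMap` of `pairT`. [folklore] -/
theorem gramTB1_eq_pairT (K : ℕ) (RV : List (List ℤ × Terms α)) : gramTB1 K RV = RV.flatMap fun a => RV.flatMap fun b => pairT K a b := rfl

/-- The row slices of a block re-assemble the block. [folklore] -/
theorem flatten_gramTB1Rows (K : ℕ) (RV : List (List ℤ × Terms α)) : (gramTB1Rows K RV).flatten = gramTB1 K RV := by
  rw [gramTB1Rows, flatten_map_eq_flatMap, gramTB1_eq_pairT]

/-- **The row slices re-assemble the two-level Gram list.** [folklore] -/
theorem flatten_gramTBRows (K : ℕ) (blocks : List (List (List ℤ × Terms α))) : (gramTBRows K blocks).flatten = gramTB K blocks := by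
  rw [gramTBRows, flatten_flatMap', gramTB]
  exact List.flatMap_congr fun RV _ => flatten_gramTB1Rows K RV

variable {ι : Type*} [LinearOrder ι] [Fintype ι]

/-- **The row slices denote the PSD two-level `gramForm`** (the `hTG` of the abstract-Gram closers with `TGs := gramTBRows K blocks`).
[cite: Han2020Bootstrap, §2 eq. (2)] [cite: WangEtAl2024, §III] -/
theorem termOp_flatten_gramTBRows (d : α → ι) (K : ℕ) (blocks : List (List (List ℤ × Terms α))) :
    termOp d (gramTBRows K blocks).flatten = gramForm (gramTBCoef K blocks) (gramTBOp d blocks) := by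
  rw [flatten_gramTBRows, termOp_gramTB_eq_gramForm]

end Rows

/-! ## §2 Half rows and the anti-Hermitian remainder -/

section Half

variable {α : Type*}

/-- **Half-row-sliced block**: row `a` against itself once and against every LATER row doubled. [cite: Han2020Bootstrap, §2 eq. (2)] -/
def gramTB1RowsHalf (K : ℕ) : List (List ℤ × Terms α) → List (Terms α)
  | [] => []
  | a :: rest => (pairT K a a ++ rest.flatMap fun b => pair2T K a b) :: gramTB1RowsHalf K rest

/-- **Half-row-sliced two-level Gram.** [cite: WangEtAl2024, §III] -/
def gramTBRowsHalf (K : ℕ) (blocks : List (List (List ℤ × Terms α))) : List (Terms α) := blocks.flatMap (gramTB1RowsHalf K)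

/-- The strict LOWER part of a block (pairs `(b, a)` with `b` later than `a`) — a proof object, never evaluated. [folklore] -/
def lowerT (K : ℕ) : List (List ℤ × Terms α) → Terms α
  | [] => []
  | a :: rest => (rest.flatMap fun b => pairT K b a) ++ lowerT K rest

/-- The strict lower part of all blocks. [folklore] -/
def lowerTB (K : ℕ) (blocks : List (List (List ℤ × Terms α))) : Terms α := blocks.flatMap (lowerT K)

/-- The integer dot product is symmetric. [folklore] -/
theorem idot_comm : ∀ r s : List ℤ, idot r s = idot s r
  | [], [] => rfl
  | [], _ :: _ => by simp [idot]
  | _ :: _, [] => by simp [idot]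
  | a :: r, b :: s => by rw [idot, idot, idot_comm r s, mul_comm]

variable {ι : Type*} [LinearOrder ι] [Fintype ι]

/-- `termOp` splits a `flatMap` of appended families. [folklore] -/
theorem termOp_flatMap_append_fun {γ : Type*} (d : α → ι) (L : List γ) (F G : γ → Terms α) :
    termOp d (L.flatMap fun x => F x ++ G x) = termOp d (L.flatMap F) + termOp d (L.flatMap G) := by
  induction L with
  | nil => simp
  | cons x L ih => rw [List.flatMap_cons, List.flatMap_cons, List.flatMap_cons, termOp_append, termOp_append, termOp_append, termOp_append, ih]; abel

/-- **A swapped pair is the adjoint pair.** [cite: BratteliRobinsonII1997, §5.2.2] -/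
theorem termOp_pairT_swap (d : α → ι) (K : ℕ) (a b : List ℤ × Terms α) : termOp d (pairT K b a) = (termOp d (pairT K a b))ᴴ := by
  rw [pairT, pairT, termOp_scaleT, termOp_scaleT, termOp_mulT, termOp_mulT, termOp_daggerT, termOp_daggerT, idot_comm b.1 a.1,
    conjTranspose_smul, conjTranspose_mul, conjTranspose_conjTranspose]
  congr 1
  rw [Complex.star_def, map_ratCast]

/-- The doubled pair denotes twice the pair. [folklore] -/
theorem termOp_pair2T (d : α → ι) (K : ℕ) (a b : List ℤ × Terms α) : termOp d (pair2T K a b) = termOp d (pairT K a b) + termOp d (pairT K a b) := by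
  rw [pair2T, pairT, termOp_scaleT, termOp_scaleT, ← add_smul, ← Rat.cast_add]
  congr 1
  push_cast
  ring

/-- A column against `a` is the adjoint of the row of `a`. [folklore] -/
theorem termOp_col_eq_adj_row (d : α → ι) (K : ℕ) (a : List ℤ × Terms α) : ∀ rest : List (List ℤ × Terms α),
    termOp d (rest.flatMap fun b => pairT K b a) = (termOp d (rest.flatMap fun b => pairT K a b))ᴴ
  | [] => by simp
  | b :: rest => by
    rw [List.flatMap_cons, List.flatMap_cons, termOp_append, termOp_append, conjTranspose_add, termOp_col_eq_adj_row d K a rest,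
      termOp_pairT_swap]

/-- The doubled row denotes twice the row. [folklore] -/
theorem termOp_row2 (d : α → ι) (K : ℕ) (a : List ℤ × Terms α) : ∀ rest : List (List ℤ × Terms α),
    termOp d (rest.flatMap fun b => pair2T K a b) = termOp d (rest.flatMap fun b => pairT K a b) + termOp d (rest.flatMap fun b => pairT K a b)
  | [] => by simp
  | b :: rest => by
    rw [List.flatMap_cons, List.flatMap_cons, termOp_append, termOp_append, termOp_row2 d K a rest, termOp_pair2T]; abel

/-- **The half-row identity for one block: `G = X − L + Lᴴ`** with `X` the half rows and `L` the strict lower part.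
[cite: Han2020Bootstrap, §2 eq. (2)] [cite: BratteliRobinsonII1997, §5.2.2] -/
theorem termOp_gramTB1_eq_half (d : α → ι) (K : ℕ) : ∀ RV : List (List ℤ × Terms α),
    termOp d (gramTB1 K RV) = termOp d (gramTB1RowsHalf K RV).flatten + termOp d (lowerT K RV) - (termOp d (lowerT K RV))ᴴ
  | [] => by simp [gramTB1, gramTB1RowsHalf, lowerT]
  | a :: rest => by
    have ih := termOp_gramTB1_eq_half d K rest
    rw [gramTB1_eq_pairT] at ih ⊢
    -- split `T(a :: rest) = P(a,a) + row(a) + column(a) + T(rest)`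
    simp only [List.flatMap_cons, termOp_append, termOp_flatMap_append_fun]
    rw [ih, gramTB1RowsHalf, List.flatten_cons, termOp_append, termOp_append, termOp_row2, lowerT, termOp_append, conjTranspose_add,
      termOp_col_eq_adj_row d K a rest, conjTranspose_conjTranspose]
    abel

/-- **The half-row identity for all blocks.** [cite: Han2020Bootstrap, §2 eq. (2)] -/
theorem termOp_gramTB_eq_half (d : α → ι) (K : ℕ) : ∀ blocks : List (List (List ℤ × Terms α)),
    termOp d (gramTB K blocks) = termOp d (gramTBRowsHalf K blocks).flatten + termOp d (lowerTB K blocks) - (termOp d (lowerTB K blocks))ᴴ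
  | [] => by simp [gramTB, gramTBRowsHalf, lowerTB]
  | RV :: blocks => by
    have ih := termOp_gramTB_eq_half d K blocks
    rw [gramTB, gramTBRowsHalf, lowerTB] at ih
    rw [gramTB, gramTBRowsHalf, lowerTB, List.flatMap_cons, List.flatMap_cons, List.flatMap_cons, termOp_append, List.flatten_append,
      termOp_append, termOp_append, conjTranspose_add, ih, termOp_gramTB1_eq_half]
    abel

/-- **The half rows denote the full Gram up to an anti-Hermitian remainder** (the `hX` of the `…GX…` closers, `V := lowerTB K blocks`).
[cite: Han2020Bootstrap, §2 eq. (2)] [cite: BratteliRobinsonII1997, §5.2.2] -/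
theorem termOp_flatten_gramTBRowsHalf (d : α → ι) (K : ℕ) (blocks : List (List (List ℤ × Terms α))) :
    termOp d (gramTBRowsHalf K blocks).flatten = termOp d (gramTB K blocks) - termOp d (lowerTB K blocks) + (termOp d (lowerTB K blocks))ᴴ := by
  rw [termOp_gramTB_eq_half]
  abel

end Half

/-! ## §3 Absorbing an anti-Hermitian Gram remainder into the adjoint family -/

section Absorb

variable {α β : Type*} {ι : Type*} [LinearOrder ι] [Fintype ι]

/-- **A Gram slice list denoting `G − V + Vᴴ` gives the residual of the FULL Gram with `V` appended to the anti-Hermitian family.**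
[cite: WangEtAl2024, §III] -/
theorem termOp_residTG_gramX (d : α → ι)
    (TX : Terms α) (μ : Fin 2 → ℚ) (ν : ℚ) (o : Fin 2 → α) (κhi hi κlo lo : ℚ) (TE : Terms α)
    (TG TGf V : Terms α) (hX : termOp d TG = termOp d TGf - termOp d V + (termOp d V)ᴴ) (TH : Terms α) (f : β → α) (EB : List (Terms β))
    {nS : ℕ} (g : Fin nS → β → α) (SY : Fin nS → Terms β) (CW : Terms α) (AV : List (Terms α)) :
    termOp d (residTG TX μ ν o κhi hi κlo lo TE TG TH f EB g SY CW AV) =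
      termOp d (residTG TX μ ν o κhi hi κlo lo TE TGf TH f EB g SY CW (AV ++ [V])) := by
  have hA : ahT (AV ++ [V]) = ahT AV ++ (daggerT V ++ negT V) := by simp [ahT, List.flatMap_append]
  simp only [residTG, hA, negT_append, termOp_append, termOp_negT, termOp_daggerT, hX]
  abel

end Absorb

/-! ## §4 The closers with an anti-Hermitian Gram remainder -/

noncomputable section GXClosers

variable {N Nβ : ℕ} [NeZero N]

/-- **CLOSER, ABSTRACT GRAM WITH ANTI-HERMITIAN REMAINDER (explicit eom masks)**: as `affineOrbitLowerRowN_of_quotAdjChainKernelCertGNear`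
but the chain's Gram slices `TGs` need only denote `termOp TGf − termOp V + (termOp V)ᴴ` for a named list `TGf` denoting a PSD `gramForm`
(`V` arbitrary, never a kernel slice). [cite: WangEtAl2024, §III] [cite: Han2020Bootstrap, §3] [cite: JanssonChaykinKeil2008, §3] -/
theorem affineOrbitLowerRowN_of_quotAdjChainKernelCertGXNear
    (tp U : ℚ) (hU : 0 ≤ U)
    {Λ Λ' : Finset (Site 2)} (hΛ : Λ ⊆ Λ') (h8 : thicken Λ 1 ⊆ Λ')
    (h0 : thicken ({0} : Finset (Site 2)) 1 ⊆ Λ') (hz : (0 : Site 2) ∈ Λ')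
    {S : Finset (DihedralGroup 4)} (h1 : (1 : DihedralGroup 4) ∈ S) (hmul : ∀ a ∈ S, ∀ b ∈ S, a * b ∈ S)
    (D : QuotData N Nβ) (hxs : ∀ i, D.xs i ∈ Λ') (hix : ∀ y ∈ Λ', D.xs (D.ix y) = y)
    (hxsβ : ∀ j, D.xsβ j ∈ Λ) (hcovβ : ∀ x ∈ Λ, ∃ j, D.xsβ j = x)
    (d : Orb (Fin N) → Orb (PolySite Λ')) (hd : Function.Injective d)
    (hdx : ∀ i σ, d (orb i σ) = orb (PolySite.pt (D.xs i) (hxs i)) σ) (Bkey : ℕ)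
    (dΛ : Orb (Fin Nβ) → Orb (PolySite Λ)) (hdΛ : ∀ j σ, dΛ (orb j σ) = orb (PolySite.pt (D.xsβ j) (hxsβ j)) σ)
    (hf : ∀ b, d (D.f b) = Orb.embMap (PolySite.incl hΛ) (dΛ b))
    (sp : Orb (Fin N) → Fin 2) (hsp : ∀ a, (ofLex (d a)).2 = sp a)
    (hokS : ∀ γc v, D.ok γc v = true → d4OfCode γc ∈ S)
    (hokV : ∀ γc v, D.ok γc v = true →
      ∀ j : Fin Nβ, D.xs (D.ix (d4Vec (d4OfCode γc) (D.xsβ j) + siteOfPair v)) = d4Vec (d4OfCode γc) (D.xsβ j) + siteOfPair v)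
    (TH : Terms (Orb (Fin N))) (hH : termOp d TH = (hubbardTTPrimeFermionInteraction 1 tp U).localHamiltonian Λ')
    (TE : Terms (Orb (Fin N)))
    (hE : termOp d TE = fermionEmbed (PolySite.incl h0) ((hubbardTTPrimeFermionInteraction 1 tp U).meanEnergyObs 1))
    (o : Fin 2 → Orb (Fin N)) (ho : ∀ σ, d (o σ) = orb (PolySite.pt 0 hz) σ)
    (TX : Terms (Orb (Fin N))) (μ : Fin 2 → ℚ) (ν κhi hi κlo lo : ℚ)
    -- the Gram: chain slices `TGs`, a named full list `TGf` denoting a PSD form, and the remainder generator `V`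
    (TGs : List (Terms (Orb (Fin N)))) (TGf V : Terms (Orb (Fin N)))
    {m : Type*} [Fintype m] [DecidableEq m] {Λm : Matrix m m ℂ} (hΛm : Λm.PosSemidef)
    (O : m → FermionOp Λ') (hTGf : termOp d TGf = gramForm Λm O)
    (hX : termOp d TGs.flatten = termOp d TGf - termOp d V + (termOp d V)ᴴ)
    (EB : List (Terms (Orb (Fin Nβ))))
    (masks : List (List Bool)) (hfar : eomFarOK TH D.f EB masks = true)
    (CW : Terms (Orb (Fin N))) (hcw : ∀ wc ∈ CW, chargeW wc.1 ≠ 0 ∨ spinChargeW sp wc.1 ≠ 0)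
    (AV : List (Terms (Orb (Fin N))))
    (ns : List ℕ) (M : ℕ) (Cs : List SOSDual.EncPoly) (hC0 : Cs.getD 0 [] = []) (Hs : List (List (QHint Nβ)))
    (hchain : ChainQAOK D Bkey M Cs
      (groupSlices (residTGslicesNear TX μ ν o κhi hi κlo lo TE TGs TH D.f EB masks
        (fun l : Fin 0 => l.elim0) (fun l : Fin 0 => l.elim0) CW AV) ns) Hs)
    {q s n₀ : ℚ} (hs : s = (μ 0 + μ 1) / 2)
    (hq : q ≤ lowerConst (SOSDual.decPoly N (Cs.getD M [])) + (μ 0 + μ 1) * (n₀ / 2 - ν)) :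
    SquareTTPrimeCorrAffineOrbitLowerRowN (tp : ℝ) (U : ℝ) q hi lo κhi κlo s n₀ S Λ' (termOp d TX) := by
  set Ts := groupSlices (residTGslicesNear TX μ ν o κhi hi κlo lo TE TGs TH D.f EB masks
    (fun l : Fin 0 => l.elim0) (fun l : Fin 0 => l.elim0) CW AV) ns with hTs
  set L := allMovesZ D Bkey Ts Hs M with hL
  set LA := allAdj D Bkey Ts Hs M with hLA
  have hLok : ∀ n, ∀ mv ∈ allMovesZ D Bkey Ts Hs n, D.ok mv.1 mv.2.1 = true := by
    intro n
    induction n with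
    | zero => intro mv hmv; rw [allMovesZ_zero] at hmv; exact absurd hmv List.not_mem_nil
    | succ n ih =>
      intro mv hmv
      rw [allMovesZ_succ, List.mem_append] at hmv
      rcases hmv with hmv | hmv
      · exact ih mv hmv
      · rw [movesOfZ, quotMovesZ, List.mem_filterMap] at hmv
        obtain ⟨a, ha, hmap⟩ := hmv
        obtain ⟨e, hae, hFe⟩ := Option.map_eq_some_iff.1 hmap
        obtain ⟨hok, -, -⟩ := annotate_ok D Bkey _ _ a ha e hae
        rw [← hFe]
        exact hok
  let γf : Fin L.length → DihedralGroup 4 := fun l => d4OfCode (L.get l).1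
  let wvf : Fin L.length → Site 2 := fun l => siteOfPair (L.get l).2.1
  let gf : Fin L.length → Orb (Fin Nβ) → Orb (Fin N) := fun l => gq D (γf l) (wvf l)
  let SYf : Fin L.length → Terms (Orb (Fin Nβ)) := fun l => (L.get l).2.2
  have hγS : ∀ l, γf l ∈ S := fun l => hokS _ _ (hLok M _ (List.get_mem L l))
  have hsh : ∀ l, d4ShiftSet (γf l) (wvf l) Λ ⊆ Λ' := fun l =>
    shiftSet_subset_of_table D hxs hcovβ (γf l) (wvf l) (hokV _ _ (hLok M _ (List.get_mem L l)))
  have hg : ∀ l b, d (gf l b) = Orb.embMap (PolySite.incl (hsh l)) (Orb.embMap (PolySite.d4Emb (γf l) (wvf l) Λ) (dΛ b)) :=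
    fun l b => by rw [← orb_ofLex_eq b]; exact d_gq D hxs d hdx hix hxsβ dΛ hdΛ (γf l) (wvf l) (hsh l) _ _
  -- the semantic residual hypothesis WITH the accepted family (as in the closer of record) …
  have hRsem : evalPoly d (SOSDual.decPoly N (Cs.getD M [])) =
      termOp d (residTG TX μ ν o κhi hi κlo lo TE TGs.flatten TH D.f EB gf SYf CW (AV ++ LA)) := by
    rw [evalPoly_chainQA_nil hd hC0 hchain, hTs, flatten_groupSlices,
      termOp_flatten_residTGslicesNear hd TX μ ν o κhi hi κlo lo TE _ TH D.f EB masks _ _ CW AV hfar,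
      termOp_residTG_moves_adj d TX μ ν o κhi hi κlo lo TE _ TH D.f EB gf SYf CW AV LA, ← hL, ← hLA, termOp_symTL_eq]
  -- … then the Gram remainder moved into the adjoint family
  rw [termOp_residTG_gramX d TX μ ν o κhi hi κlo lo TE TGs.flatten TGf V hX TH D.f EB gf SYf CW (AV ++ LA)] at hRsem
  exact affineOrbitLowerRowN_of_residPolyG tp U hU hΛ h8 h0 hz h1 hmul d dΛ D.f hf sp hsp TH hH TE hE o ho TX μ ν κhi hi κlo lo
    TGf hΛm O hTGf EB γf hγS wvf hsh gf hg SYf CW hcw ((AV ++ LA) ++ [V]) hRsem hs hq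

/-- **CLOSER, ABSTRACT GRAM WITH ANTI-HERMITIAN REMAINDER, KERNEL-COMPUTED EOM MASKS.** [cite: WangEtAl2024, §III] [cite: Han2020Bootstrap, §3]
[cite: JanssonChaykinKeil2008, §3] -/
theorem affineOrbitLowerRowN_of_quotAdjChainKernelCertGXAuto
    (tp U : ℚ) (hU : 0 ≤ U)
    {Λ Λ' : Finset (Site 2)} (hΛ : Λ ⊆ Λ') (h8 : thicken Λ 1 ⊆ Λ')
    (h0 : thicken ({0} : Finset (Site 2)) 1 ⊆ Λ') (hz : (0 : Site 2) ∈ Λ')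
    {S : Finset (DihedralGroup 4)} (h1 : (1 : DihedralGroup 4) ∈ S) (hmul : ∀ a ∈ S, ∀ b ∈ S, a * b ∈ S)
    (D : QuotData N Nβ) (hxs : ∀ i, D.xs i ∈ Λ') (hix : ∀ y ∈ Λ', D.xs (D.ix y) = y)
    (hxsβ : ∀ j, D.xsβ j ∈ Λ) (hcovβ : ∀ x ∈ Λ, ∃ j, D.xsβ j = x)
    (d : Orb (Fin N) → Orb (PolySite Λ')) (hd : Function.Injective d)
    (hdx : ∀ i σ, d (orb i σ) = orb (PolySite.pt (D.xs i) (hxs i)) σ) (Bkey : ℕ)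
    (dΛ : Orb (Fin Nβ) → Orb (PolySite Λ)) (hdΛ : ∀ j σ, dΛ (orb j σ) = orb (PolySite.pt (D.xsβ j) (hxsβ j)) σ)
    (hf : ∀ b, d (D.f b) = Orb.embMap (PolySite.incl hΛ) (dΛ b))
    (sp : Orb (Fin N) → Fin 2) (hsp : ∀ a, (ofLex (d a)).2 = sp a)
    (hokS : ∀ γc v, D.ok γc v = true → d4OfCode γc ∈ S)
    (hokV : ∀ γc v, D.ok γc v = true →
      ∀ j : Fin Nβ, D.xs (D.ix (d4Vec (d4OfCode γc) (D.xsβ j) + siteOfPair v)) = d4Vec (d4OfCode γc) (D.xsβ j) + siteOfPair v)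
    (TH : Terms (Orb (Fin N))) (hH : termOp d TH = (hubbardTTPrimeFermionInteraction 1 tp U).localHamiltonian Λ')
    (TE : Terms (Orb (Fin N)))
    (hE : termOp d TE = fermionEmbed (PolySite.incl h0) ((hubbardTTPrimeFermionInteraction 1 tp U).meanEnergyObs 1))
    (o : Fin 2 → Orb (Fin N)) (ho : ∀ σ, d (o σ) = orb (PolySite.pt 0 hz) σ)
    (TX : Terms (Orb (Fin N))) (μ : Fin 2 → ℚ) (ν κhi hi κlo lo : ℚ)
    (TGs : List (Terms (Orb (Fin N)))) (TGf V : Terms (Orb (Fin N)))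
    {m : Type*} [Fintype m] [DecidableEq m] {Λm : Matrix m m ℂ} (hΛm : Λm.PosSemidef)
    (O : m → FermionOp Λ') (hTGf : termOp d TGf = gramForm Λm O)
    (hX : termOp d TGs.flatten = termOp d TGf - termOp d V + (termOp d V)ᴴ)
    (EB : List (Terms (Orb (Fin Nβ))))
    (CW : Terms (Orb (Fin N))) (hcw : ∀ wc ∈ CW, chargeW wc.1 ≠ 0 ∨ spinChargeW sp wc.1 ≠ 0)
    (AV : List (Terms (Orb (Fin N))))
    (ns : List ℕ) (M : ℕ) (Cs : List SOSDual.EncPoly) (hC0 : Cs.getD 0 [] = []) (Hs : List (List (QHint Nβ)))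
    (hchain : ChainQAOK D Bkey M Cs
      (groupSlices (residTGslicesNear TX μ ν o κhi hi κlo lo TE TGs TH D.f EB (autoMasks TH D.f EB)
        (fun l : Fin 0 => l.elim0) (fun l : Fin 0 => l.elim0) CW AV) ns) Hs)
    {q s n₀ : ℚ} (hs : s = (μ 0 + μ 1) / 2)
    (hq : q ≤ lowerConst (SOSDual.decPoly N (Cs.getD M [])) + (μ 0 + μ 1) * (n₀ / 2 - ν)) :
    SquareTTPrimeCorrAffineOrbitLowerRowN (tp : ℝ) (U : ℝ) q hi lo κhi κlo s n₀ S Λ' (termOp d TX) :=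
  affineOrbitLowerRowN_of_quotAdjChainKernelCertGXNear tp U hU hΛ h8 h0 hz h1 hmul D hxs hix hxsβ hcovβ d hd hdx Bkey dΛ hdΛ hf sp hsp
    hokS hokV TH hH TE hE o ho TX μ ν κhi hi κlo lo TGs TGf V hΛm O hTGf hX EB (autoMasks TH D.f EB) (eomFarOK_autoMasks TH D.f EB) CW hcw
    AV ns M Cs hC0 Hs hchain hs hq

/-- **CLOSER, TWO-LEVEL GRAM BY HALF ROWS, KERNEL-COMPUTED EOM MASKS**: `TGs := gramTBRowsHalf K blocks` (products ÷2), PSD-ness and the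
anti-Hermitian remainder discharged here; the instance proves table facts, the chain facts and ONE inequality. [cite: WangEtAl2024, §III]
[cite: Han2020Bootstrap, §2 eq. (2)] [cite: JanssonChaykinKeil2008, §3] -/
theorem affineOrbitLowerRowN_of_quotAdjChainKernelCertTBRowsHalfAuto
    (tp U : ℚ) (hU : 0 ≤ U)
    {Λ Λ' : Finset (Site 2)} (hΛ : Λ ⊆ Λ') (h8 : thicken Λ 1 ⊆ Λ')
    (h0 : thicken ({0} : Finset (Site 2)) 1 ⊆ Λ') (hz : (0 : Site 2) ∈ Λ')
    {S : Finset (DihedralGroup 4)} (h1 : (1 : DihedralGroup 4) ∈ S) (hmul : ∀ a ∈ S, ∀ b ∈ S, a * b ∈ S)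
    (D : QuotData N Nβ) (hxs : ∀ i, D.xs i ∈ Λ') (hix : ∀ y ∈ Λ', D.xs (D.ix y) = y)
    (hxsβ : ∀ j, D.xsβ j ∈ Λ) (hcovβ : ∀ x ∈ Λ, ∃ j, D.xsβ j = x)
    (d : Orb (Fin N) → Orb (PolySite Λ')) (hd : Function.Injective d)
    (hdx : ∀ i σ, d (orb i σ) = orb (PolySite.pt (D.xs i) (hxs i)) σ) (Bkey : ℕ)
    (dΛ : Orb (Fin Nβ) → Orb (PolySite Λ)) (hdΛ : ∀ j σ, dΛ (orb j σ) = orb (PolySite.pt (D.xsβ j) (hxsβ j)) σ)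
    (hf : ∀ b, d (D.f b) = Orb.embMap (PolySite.incl hΛ) (dΛ b))
    (sp : Orb (Fin N) → Fin 2) (hsp : ∀ a, (ofLex (d a)).2 = sp a)
    (hokS : ∀ γc v, D.ok γc v = true → d4OfCode γc ∈ S)
    (hokV : ∀ γc v, D.ok γc v = true →
      ∀ j : Fin Nβ, D.xs (D.ix (d4Vec (d4OfCode γc) (D.xsβ j) + siteOfPair v)) = d4Vec (d4OfCode γc) (D.xsβ j) + siteOfPair v)
    (TH : Terms (Orb (Fin N))) (hH : termOp d TH = (hubbardTTPrimeFermionInteraction 1 tp U).localHamiltonian Λ')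
    (TE : Terms (Orb (Fin N)))
    (hE : termOp d TE = fermionEmbed (PolySite.incl h0) ((hubbardTTPrimeFermionInteraction 1 tp U).meanEnergyObs 1))
    (o : Fin 2 → Orb (Fin N)) (ho : ∀ σ, d (o σ) = orb (PolySite.pt 0 hz) σ)
    (TX : Terms (Orb (Fin N))) (μ : Fin 2 → ℚ) (ν κhi hi κlo lo : ℚ) (K : ℕ)
    (blocks : List (List (List ℤ × Terms (Orb (Fin N))))) (EB : List (Terms (Orb (Fin Nβ))))
    (CW : Terms (Orb (Fin N))) (hcw : ∀ wc ∈ CW, chargeW wc.1 ≠ 0 ∨ spinChargeW sp wc.1 ≠ 0)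
    (AV : List (Terms (Orb (Fin N))))
    (ns : List ℕ) (M : ℕ) (Cs : List SOSDual.EncPoly) (hC0 : Cs.getD 0 [] = []) (Hs : List (List (QHint Nβ)))
    (hchain : ChainQAOK D Bkey M Cs
      (groupSlices (residTGslicesNear TX μ ν o κhi hi κlo lo TE (gramTBRowsHalf K blocks) TH D.f EB (autoMasks TH D.f EB)
        (fun l : Fin 0 => l.elim0) (fun l : Fin 0 => l.elim0) CW AV) ns) Hs)
    {q s n₀ : ℚ} (hs : s = (μ 0 + μ 1) / 2)
    (hq : q ≤ lowerConst (SOSDual.decPoly N (Cs.getD M [])) + (μ 0 + μ 1) * (n₀ / 2 - ν)) :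
    SquareTTPrimeCorrAffineOrbitLowerRowN (tp : ℝ) (U : ℝ) q hi lo κhi κlo s n₀ S Λ' (termOp d TX) :=
  affineOrbitLowerRowN_of_quotAdjChainKernelCertGXAuto tp U hU hΛ h8 h0 hz h1 hmul D hxs hix hxsβ hcovβ d hd hdx Bkey dΛ hdΛ hf sp hsp
    hokS hokV TH hH TE hE o ho TX μ ν κhi hi κlo lo (gramTBRowsHalf K blocks) (gramTB K blocks) (lowerTB K blocks)
    (gramTBCoef_posSemidef K blocks) (gramTBOp d blocks) (termOp_gramTB_eq_gramForm d K blocks) (termOp_flatten_gramTBRowsHalf d K blocks)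
    EB CW hcw AV ns M Cs hC0 Hs hchain hs hq

end GXClosers

end CARPolyWindow

end Summit.Ventures.CertifiedManyBodySolver
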